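import Literature.RingTheory.MvPowerSeries.OptionEquivLeft
import Literature.RingTheory.MvPowerSeries.MaximalIdealPow
import Literature.AlgebraicGeometry.Resolution.PowerSeriesRegularLocal
import Mathlib.RingTheory.PowerSeries.WeierstrassPreparation
import Mathlib.RingTheory.MvPowerSeries.Substitution
import Mathlib.Algebra.Polynomial.Taylor
import HarnessLib

/-!
# The shift `T ↦ T + θ` of `S⟦T⟧` over `S = L⟦x⟧`, Taylor coefficients along `(T − θ, q)`, and
# Weierstrass normal form of an ideal containing a `T`-regular element of order one (Mulay 1983, §2–§3)

Topic: `Literature/AlgebraicGeometry/Resolution`. Second brick of the discharge of the named fact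
`Mulay1983_codimTwoHyperplanar` (`Mulay1983Hyperplanarity.lean`); S. B. Mulay, *Equimultiplicity and
hyperplanarity*, Proc. Amer. Math. Soc. **89** (1983) 407–413 (lit key `paper:url-29aeafb0cf6c`).
Mulay works in `R = S⟦z⟧` (2.3: "`(R̂, Ŝ, z)` is a triode and `R̂ = Ŝ⟦z⟧`"), writes the hypersurface
as a Weierstrass polynomial `f(Z) = Z^d + b(1)Z^{d−1} + ⋯ + b(d)` (2.4, 2.6) and studies the primes
`P ⊇ (f)` with `f ∈ P^{(d)}` through the elements `Z − θ` they contain (3.1 (iii):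
"If `Z − θ` belongs to `P` … then `P = (Z − θ)A + QA`"; 3.3: order of `f(θ)` along `Q`). We supply,
with complete proofs and no new definitions:

* `PowerSeries.dvd_coeff_of_mem_span_X_C_pow` — over ANY commutative ring: if
  `h ∈ (T, q)^n ⊆ A⟦T⟧` then `q^{n−m} ∣ [T^m] h` (coefficient form of membership in a power of the
  prime `(T, q)`; the triode order estimate of Mulay 2.1/3.3 in the case we need);
* (private) `MvPowerSeries.algHom_ext_X'` — `L`-algebra maps `L⟦x_σ⟧ → L⟦x_τ⟧` agreeing on the variables are
  equal (the tree's `Jets.algHom_ext_X` for endomorphisms, verbatim with two index types);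
* `exists_shift` — for `S = L⟦x_σ⟧` (`σ` finite, `L` a field) and `θ ∈ 𝔪_S`, a ring automorphism
  `sh` of `S⟦T⟧` with `sh T = T + C θ` and `sh (C p) = C p` (the `S`-automorphism `T ↦ T + θ`,
  built from Mathlib's `MvPowerSeries.subst` on `L⟦x_{Option σ}⟧` through the tree's `optionEquivLeft`);
  consequences (private) `map_coe_eq_coe_taylor` (`sh f = taylor θ f` on polynomials) and
  `taylor_coeff_dvd_of_coe_mem_pow` — **if `f ∈ (T − θ, q)^n` then `q^{n−m} ∣ (taylor θ f)_m`**
  (Mulay 3.3 for the prime `(Z − θ, q)`: "`f(θ)a^d` is in `B ∩ Q^{(d)}`", here with all Taylor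
  coefficients);
* `map_eq_X_sub_C_pow_of_taylor`, `eq_of_X_sub_C_pow_eq` — `f ≡ (Z − θ)^n (mod q)` and
  uniqueness of `θ (mod q)` over a reduced quotient (Mulay 3.4 (ii)/3.5: `Q` determines `P`);
* `exists_span_pair_eq_span_X_sub_C` — **Weierstrass normal form of a smooth centre**: if
  `w ∈ S⟦T⟧` has `[T⁰]w ∈ 𝔪_S` and `[T¹]w ∈ S^×` then for every `v`,
  `(w, v) = (T − C θ, C q)` for some `θ ∈ 𝔪_S`, `q ∈ S` (Mathlib's Weierstrass preparation in
  degree one + the shift; Mulay 3.1 (iii) with 2.4).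

No statement of H. Hironaka's 2017 manuscript is involved. AI formalisation; weaker than expert
review.

## References
* S. B. Mulay, *Equimultiplicity and hyperplanarity*, Proc. Amer. Math. Soc. 89 (1983) 407–413,
  §2.1–2.6, 3.1, 3.3–3.5. [Mulay1983]
* L. C. Washington, *Introduction to Cyclotomic Fields*, Thm. 7.3 (Weierstrass preparation) — via
  Mathlib `Mathlib.RingTheory.PowerSeries.WeierstrassPreparation`. [folklore]
-/

noncomputable section

namespace Literature.AlgebraicGeometry.Resolution

namespace Mulay1983

open IsLocalRing Polynomial Finset Literature.RingTheory.MvPowerSeries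

universe u v

/-! ## 1. Coefficients of elements of `(T, q)^n ⊆ A⟦T⟧` -/

section CoeffPow

variable {A : Type u} [CommRing A]

/-- **Coefficients along `(T, q)^n`.** Over any commutative ring `A`: if `h ∈ (T, C q)^n ⊆ A⟦T⟧`
then `q^{n−m} ∣ [T^m] h` for every `m` (for `m ≥ n` this is vacuous). Proof: the sets
`M_k = {h | ∀ m, q^{k−m} ∣ [T^m] h}` are ideals with `M_a M_b ⊆ M_{a+b}` and `T, q ∈ M_1`. This is
the coefficient form of "`ord` along the prime `(Z, Q)` is at least `n`" used in Mulay 2.1/3.3.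
[cite: Mulay1983, 2.1 and 3.3 (order estimate in a triode), pp. 409–411] -/
theorem PowerSeries.dvd_coeff_of_mem_span_X_C_pow (q : A) {n : ℕ} {h : PowerSeries A}
    (hh : h ∈ (Ideal.span {PowerSeries.X, PowerSeries.C q}) ^ n) (m : ℕ) :
    q ^ (n - m) ∣ PowerSeries.coeff m h := by
  -- the filtration `M k`
  let M : ℕ → Ideal (PowerSeries A) := fun k =>
    { carrier := {h | ∀ m : ℕ, q ^ (k - m) ∣ PowerSeries.coeff m h}
      add_mem' := by
        intro a b ha hb m
        rw [map_add]; exact dvd_add (ha m) (hb m)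
      zero_mem' := fun m => by rw [map_zero]; exact dvd_zero _
      smul_mem' := by
        intro r h hh m
        rw [smul_eq_mul, PowerSeries.coeff_mul]
        refine Finset.dvd_sum fun ij hij => ?_
        have hij' : ij.1 + ij.2 = m := Finset.HasAntidiagonal.mem_antidiagonal.mp hij
        have h1 : q ^ (k - m) ∣ q ^ (k - ij.2) := pow_dvd_pow q (by omega)
        exact Dvd.dvd.mul_left (h1.trans (hh ij.2)) _ }
  have hM : ∀ (k : ℕ) (g : PowerSeries A), g ∈ M k ↔ ∀ m : ℕ, q ^ (k - m) ∣ PowerSeries.coeff m g :=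
    fun k g => Iff.rfl
  -- multiplicativity
  have hmul : ∀ a b : ℕ, M a * M b ≤ M (a + b) := by
    intro a b
    rw [Ideal.mul_le]
    intro h hh k hk m
    rw [PowerSeries.coeff_mul]
    refine Finset.dvd_sum fun ij hij => ?_
    have hij' : ij.1 + ij.2 = m := Finset.HasAntidiagonal.mem_antidiagonal.mp hij
    have h1 : q ^ (a + b - m) ∣ q ^ ((a - ij.1) + (b - ij.2)) := pow_dvd_pow q (by omega)
    rw [pow_add] at h1
    exact h1.trans (mul_dvd_mul (hh ij.1) (hk ij.2))
  -- the generators lie in `M 1`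
  have hgen : Ideal.span {PowerSeries.X, PowerSeries.C q} ≤ M 1 := by
    rw [Ideal.span_le]
    rintro g hg
    simp only [Set.mem_insert_iff, Set.mem_singleton_iff] at hg
    rcases hg with rfl | rfl
    · intro m
      rw [PowerSeries.coeff_X]
      split_ifs with hm
      · subst hm; simp
      · exact dvd_zero _
    · intro m
      rw [PowerSeries.coeff_C]
      split_ifs with hm
      · subst hm; simp
      · exact dvd_zero _
  -- `(T, q)^k ⊆ M k`
  have hpow : ∀ k : ℕ, (Ideal.span {PowerSeries.X, PowerSeries.C q}) ^ k ≤ M k := by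
    intro k
    induction k with
    | zero => intro h _ m; rw [Nat.zero_sub, pow_zero]; exact one_dvd _
    | succ k ih =>
      rw [pow_succ]
      exact (Ideal.mul_mono ih hgen).trans (hmul k 1)
  exact (hM n h).mp (hpow n hh) m

end CoeffPow

/-! ## 2. `L`-algebra maps between power series rings over a field are determined by the variables -/

section AlgHomExt

variable {L : Type u} [Field L] {σ τ : Type v}

/-- An `L`-algebra map `L⟦x_σ⟧ → L⟦x_τ⟧` is local: it maps `𝔪` into `𝔪` (if `φ f` had constant
coefficient `c ≠ 0` for `f ∈ 𝔪` then `f − c` is a unit and `φ(f − c) = φ f − c` is not). The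
tree's `Jets.algHom_apply_mem_maximalIdeal` with two index types. [folklore] -/
private theorem MvPowerSeries.algHom_apply_mem_maximalIdeal' (φ : MvPowerSeries σ L →ₐ[L] MvPowerSeries τ L)
    {f : MvPowerSeries σ L} (hf : f ∈ maximalIdeal (MvPowerSeries σ L)) :
    φ f ∈ maximalIdeal (MvPowerSeries τ L) := by
  rw [Jets.mem_maximalIdeal_iff_constantCoeff_eq_zero] at hf ⊢
  by_contra hc
  have hC : ∀ c : L, φ (MvPowerSeries.C c) = MvPowerSeries.C c := fun c => by
    rw [MvPowerSeries.c_eq_algebraMap, MvPowerSeries.c_eq_algebraMap]; exact φ.commutes c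
  have hu : IsUnit (f - MvPowerSeries.C (MvPowerSeries.constantCoeff (φ f))) := by
    rw [MvPowerSeries.isUnit_iff_constantCoeff, map_sub, hf, MvPowerSeries.constantCoeff_C, zero_sub,
      isUnit_iff_ne_zero, neg_ne_zero]
    exact hc
  have hnu : ¬ IsUnit (φ (f - MvPowerSeries.C (MvPowerSeries.constantCoeff (φ f)))) := by
    rw [map_sub, hC, MvPowerSeries.isUnit_iff_constantCoeff, map_sub, MvPowerSeries.constantCoeff_C,
      sub_self]
    exact not_isUnit_zero
  exact hnu (hu.map φ)

/-- An `L`-algebra map `L⟦x_σ⟧ → L⟦x_τ⟧` maps `𝔪 ^ N` into `𝔪 ^ N`. [folklore] -/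
private theorem MvPowerSeries.algHom_apply_mem_maximalIdeal_pow' (φ : MvPowerSeries σ L →ₐ[L] MvPowerSeries τ L)
    {N : ℕ} {f : MvPowerSeries σ L} (hf : f ∈ maximalIdeal (MvPowerSeries σ L) ^ N) :
    φ f ∈ maximalIdeal (MvPowerSeries τ L) ^ N := by
  have hle : (maximalIdeal (MvPowerSeries σ L) ^ N).map (φ : MvPowerSeries σ L →+* MvPowerSeries τ L) ≤
      maximalIdeal (MvPowerSeries τ L) ^ N := by
    rw [Ideal.map_pow]
    refine Ideal.pow_right_mono ?_ N
    rw [Ideal.map_le_iff_le_comap]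
    intro g hg
    exact MvPowerSeries.algHom_apply_mem_maximalIdeal' φ hg
  exact hle (Ideal.mem_map_of_mem _ hf)

variable [Finite σ]

/-- **`L`-algebra maps `L⟦x_σ⟧ → L⟦x_τ⟧` agreeing on the variables are equal** (they agree on
polynomials, and are `𝔪`-adically contracting, so agree modulo every power of `𝔪`). The tree's
`Jets.algHom_ext_X` for endomorphisms, with two index types. [folklore] -/
private theorem MvPowerSeries.algHom_ext_X' {φ ψ : MvPowerSeries σ L →ₐ[L] MvPowerSeries τ L}
    (h : ∀ s, φ (MvPowerSeries.X s) = ψ (MvPowerSeries.X s)) : φ = ψ := by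
  -- agreement on polynomials
  have hcoe : ∀ p : MvPolynomial σ L, φ (↑p) = ψ (↑p) := by
    intro p
    have key : (φ.comp (MvPolynomial.coeToMvPowerSeries.algHom L)) =
        (ψ.comp (MvPolynomial.coeToMvPowerSeries.algHom L)) := by
      apply MvPolynomial.algHom_ext
      intro s
      simp only [AlgHom.coe_comp, Function.comp_apply, MvPolynomial.coeToMvPowerSeries.algHom_apply,
        Algebra.algebraMap_self, MvPowerSeries.map_id, MvPolynomial.coe_X, RingHom.id_apply]
      exact h s
    have := congrArg (fun χ => χ p) key
    simpa only [AlgHom.coe_comp, Function.comp_apply, MvPolynomial.coeToMvPowerSeries.algHom_apply,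
      Algebra.algebraMap_self, MvPowerSeries.map_id, RingHom.id_apply] using this
  ext f e
  have hmem : φ f - ψ f ∈ maximalIdeal (MvPowerSeries τ L) ^ (e.degree + 1) := by
    have hsplit : f = ↑(MvPowerSeries.truncTotal (e.degree + 1) f) +
        (f - ↑(MvPowerSeries.truncTotal (e.degree + 1) f)) := by ring
    rw [hsplit, map_add, map_add, hcoe, add_sub_add_left_eq_sub]
    exact Ideal.sub_mem _
      (MvPowerSeries.algHom_apply_mem_maximalIdeal_pow' φ (Jets.sub_coe_truncTotal_mem_maximalIdeal_pow _ f))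
      (MvPowerSeries.algHom_apply_mem_maximalIdeal_pow' ψ (Jets.sub_coe_truncTotal_mem_maximalIdeal_pow _ f))
  have := Jets.coeff_eq_zero_of_mem_maximalIdeal_pow hmem (Nat.lt_succ_self e.degree)
  rwa [map_sub, sub_eq_zero] at this

end AlgHomExt

/-! ## 3. The shift `T ↦ T + θ` of `S⟦T⟧`, `S = L⟦x_σ⟧`, `θ ∈ 𝔪_S` -/

section Shift

variable {L : Type u} [Field L] {σ : Type v} [Finite σ]

/-- **The `S`-automorphism `T ↦ T + θ` of `S⟦T⟧`** for `S = L⟦x_σ⟧` and `θ ∈ 𝔪_S` (zero constant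
term): a ring automorphism `sh` with `sh T = T + C θ` and `sh (C p) = C p` for all `p ∈ S`. It is
Mathlib's substitution `x_none ↦ x_none + θ`, `x_s ↦ x_s` of `L⟦x_{Option σ}⟧` transported along the
tree's `optionEquivLeft : L⟦x_{Option σ}⟧ ≃ S⟦T⟧`; that the substitution fixes the series in the
variables `x_s` is `MvPowerSeries.algHom_ext_X'`. (Mulay 2.2/2.3 identify `S[z] ≅ S[Z]` and
`R̂ = Ŝ⟦z⟧`; the shift is the change of the Weierstrass variable `Z ↦ Z − θ` of 3.1 (iii)/3.2.)
[cite: Mulay1983, 2.2–2.3 and 3.1 (iii), pp. 409–410] -/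
theorem exists_shift (θ : MvPowerSeries σ L) (hθ : MvPowerSeries.constantCoeff θ = 0) :
    ∃ sh : PowerSeries (MvPowerSeries σ L) ≃+* PowerSeries (MvPowerSeries σ L),
      sh PowerSeries.X = PowerSeries.X + PowerSeries.C θ ∧
        ∀ p : MvPowerSeries σ L, sh (PowerSeries.C p) = PowerSeries.C p := by
  classical
  let S := MvPowerSeries σ L
  let R := MvPowerSeries (Option σ) L
  let E : R ≃+* PowerSeries S := optionEquivLeft
  -- the inclusion `ι : S → R` of the series in the variables `x_s`, as an `L`-algebra map
  let ι : S →ₐ[L] R :=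
    { toRingHom := E.symm.toRingHom.comp (PowerSeries.C (R := S))
      commutes' := fun c => by
        change E.symm (PowerSeries.C (algebraMap L S c)) = algebraMap L R c
        have h1 : algebraMap L S c = MvPowerSeries.C c := by
          rw [MvPowerSeries.algebraMap_apply, Algebra.algebraMap_self, RingHom.id_apply]
        have h2 : algebraMap L R c = MvPowerSeries.C c := by
          rw [MvPowerSeries.algebraMap_apply, Algebra.algebraMap_self, RingHom.id_apply]
        rw [h1, h2, ← optionEquivLeft_C, RingEquiv.symm_apply_apply] }
  have hι : ∀ p : S, ι p = E.symm (PowerSeries.C p) := fun p => rfl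
  have hιX : ∀ s : σ, ι (MvPowerSeries.X s) = MvPowerSeries.X (some s) := fun s => by
    rw [hι, ← optionEquivLeft_X_some, RingEquiv.symm_apply_apply]
  have hιconst : ∀ p : S, MvPowerSeries.constantCoeff (ι p) = MvPowerSeries.constantCoeff p := by
    intro p
    rw [hι, ← MvPowerSeries.coeff_zero_eq_constantCoeff_apply, coeff_optionEquivLeft_symm,
      ← MvPowerSeries.coeff_zero_eq_constantCoeff_apply]
    simp
  -- the two substitutions
  let a : Option σ → R := fun o => o.elim (MvPowerSeries.X none + ι θ) fun s => MvPowerSeries.X (some s)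
  let a' : Option σ → R := fun o => o.elim (MvPowerSeries.X none - ι θ) fun s => MvPowerSeries.X (some s)
  have ha : MvPowerSeries.HasSubst a := by
    refine MvPowerSeries.hasSubst_of_constantCoeff_zero fun o => ?_
    cases o with
    | none => change MvPowerSeries.constantCoeff (MvPowerSeries.X none + ι θ) = 0
              rw [map_add, MvPowerSeries.constantCoeff_X, hιconst, hθ, add_zero]
    | some s => exact MvPowerSeries.constantCoeff_X _
  have ha' : MvPowerSeries.HasSubst a' := by
    refine MvPowerSeries.hasSubst_of_constantCoeff_zero fun o => ?_
    cases o with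
    | none => change MvPowerSeries.constantCoeff (MvPowerSeries.X none - ι θ) = 0
              rw [map_sub, MvPowerSeries.constantCoeff_X, hιconst, hθ, sub_zero]
    | some s => exact MvPowerSeries.constantCoeff_X _
  let φ : R →ₐ[L] R := MvPowerSeries.substAlgHom ha
  let φ' : R →ₐ[L] R := MvPowerSeries.substAlgHom ha'
  have hφ : ∀ f, φ f = MvPowerSeries.subst a f := fun f => MvPowerSeries.substAlgHom_apply ha f
  have hφ' : ∀ f, φ' f = MvPowerSeries.subst a' f := fun f => MvPowerSeries.substAlgHom_apply ha' f
  -- both substitutions fix `ι p`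
  have hfix : ∀ (b : Option σ → R) (hb : MvPowerSeries.HasSubst b),
      (∀ s, b (some s) = MvPowerSeries.X (some s)) → ∀ p : S, MvPowerSeries.subst b (ι p) = ι p := by
    intro b hb hbs p
    have key : (MvPowerSeries.substAlgHom hb).comp ι = ι := by
      apply MvPowerSeries.algHom_ext_X'
      intro s
      rw [AlgHom.comp_apply, hιX, MvPowerSeries.substAlgHom_apply, MvPowerSeries.subst_X hb, hbs]
    have := congrArg (fun χ => χ p) key
    simpa only [AlgHom.comp_apply, MvPowerSeries.substAlgHom_apply] using this
  have hfixa : ∀ p : S, MvPowerSeries.subst a (ι p) = ι p := hfix a ha fun s => rfl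
  have hfixa' : ∀ p : S, MvPowerSeries.subst a' (ι p) = ι p := hfix a' ha' fun s => rfl
  -- they are mutually inverse
  have hinv1 : ∀ f, φ' (φ f) = f := by
    intro f
    rw [hφ, hφ', MvPowerSeries.subst_comp_subst_apply ha ha']
    have hX : (fun o => MvPowerSeries.subst a' (a o)) = MvPowerSeries.X := by
      funext o
      cases o with
      | none =>
        change MvPowerSeries.subst a' (MvPowerSeries.X none + ι θ) = MvPowerSeries.X none
        rw [MvPowerSeries.subst_add ha', MvPowerSeries.subst_X ha', hfixa']
        change MvPowerSeries.X none - ι θ + ι θ = _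
        abel
      | some s =>
        change MvPowerSeries.subst a' (MvPowerSeries.X (some s)) = MvPowerSeries.X (some s)
        rw [MvPowerSeries.subst_X ha']; rfl
    rw [hX, MvPowerSeries.subst_self]; rfl
  have hinv2 : ∀ f, φ (φ' f) = f := by
    intro f
    rw [hφ, hφ', MvPowerSeries.subst_comp_subst_apply ha' ha]
    have hX : (fun o => MvPowerSeries.subst a (a' o)) = MvPowerSeries.X := by
      funext o
      cases o with
      | none =>
        change MvPowerSeries.subst a (MvPowerSeries.X none - ι θ) = MvPowerSeries.X none
        rw [MvPowerSeries.subst_sub ha, MvPowerSeries.subst_X ha, hfixa]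
        change MvPowerSeries.X none + ι θ - ι θ = _
        abel
      | some s =>
        change MvPowerSeries.subst a (MvPowerSeries.X (some s)) = MvPowerSeries.X (some s)
        rw [MvPowerSeries.subst_X ha]; rfl
    rw [hX, MvPowerSeries.subst_self]; rfl
  let Φ : R ≃+* R :=
    { toFun := φ, invFun := φ', left_inv := hinv1, right_inv := hinv2,
      map_mul' := fun x y => map_mul φ x y, map_add' := fun x y => map_add φ x y }
  refine ⟨E.symm.trans (Φ.trans E), ?_, fun p => ?_⟩
  · change E (φ (E.symm PowerSeries.X)) = _
    rw [← optionEquivLeft_X_none, RingEquiv.symm_apply_apply, hφ, MvPowerSeries.subst_X ha]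
    change E (MvPowerSeries.X none + ι θ) = _
    rw [map_add, optionEquivLeft_X_none, hι, RingEquiv.apply_symm_apply]
  · change E (φ (E.symm (PowerSeries.C p))) = _
    rw [← hι, hφ, hfixa, hι, RingEquiv.apply_symm_apply]

end Shift

/-! ## 4. Taylor coefficients along `(T − θ, q)` -/

section Taylor

variable {S : Type u} [CommRing S]

/-- A ring endomorphism of `S⟦T⟧` fixing `S` with `T ↦ T + θ` acts on polynomials as `taylor θ`.
[folklore] -/
private theorem map_coe_eq_coe_taylor (sh : PowerSeries S →+* PowerSeries S) {θ : S}
    (hX : sh PowerSeries.X = PowerSeries.X + PowerSeries.C θ) (hC : ∀ p : S, sh (PowerSeries.C p) = PowerSeries.C p)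
    (f : S[X]) : sh (f : PowerSeries S) = ((taylor θ f : S[X]) : PowerSeries S) := by
  have key : sh.comp (Polynomial.coeToPowerSeries.ringHom (R := S)) =
      (Polynomial.coeToPowerSeries.ringHom (R := S)).comp (Polynomial.compRingHom (X + C θ)) := by
    apply Polynomial.ringHom_ext
    · intro c
      simp only [RingHom.comp_apply, Polynomial.coe_compRingHom_apply, Polynomial.C_comp]
      change sh ((Polynomial.C c : S[X]) : PowerSeries S) = ((Polynomial.C c : S[X]) : PowerSeries S)
      rw [Polynomial.coe_C, hC]
    · simp only [RingHom.comp_apply, Polynomial.coe_compRingHom_apply, Polynomial.X_comp]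
      change sh ((Polynomial.X : S[X]) : PowerSeries S) = ((Polynomial.X + Polynomial.C θ : S[X]) : PowerSeries S)
      rw [Polynomial.coe_X, hX, Polynomial.coe_add, Polynomial.coe_X, Polynomial.coe_C]
  have := congrArg (fun χ => χ f) key
  simpa only [RingHom.comp_apply, Polynomial.coe_compRingHom_apply, taylor_apply,
    Polynomial.coeToPowerSeries.ringHom_apply] using this

/-- **Taylor coefficients along `(T − θ, q)`.** If `sh` is a ring automorphism of `S⟦T⟧` fixing `S`
with `sh T = T + θ`, and a polynomial `f` satisfies `f ∈ (T − θ, q)^n` in `S⟦T⟧`, then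
`q^{n−m} ∣ (taylor θ f)_m` for all `m` — i.e. `f(θ) ∈ (q^n)`, `f'(θ) ∈ (q^{n−1})`, …: Mulay's 3.3
("`f(θ)a^d` is in `B ∩ Q^{(d)}`") for the prime `(Z − θ, q)`, sharpened to all Taylor coefficients.
[cite: Mulay1983, 3.3 p. 411] -/
theorem taylor_coeff_dvd_of_coe_mem_pow (sh : PowerSeries S ≃+* PowerSeries S) {θ : S}
    (hX : sh PowerSeries.X = PowerSeries.X + PowerSeries.C θ) (hC : ∀ p : S, sh (PowerSeries.C p) = PowerSeries.C p)
    (q : S) {n : ℕ} {f : S[X]}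
    (hf : (f : PowerSeries S) ∈ (Ideal.span {PowerSeries.X - PowerSeries.C θ, PowerSeries.C q}) ^ n) (m : ℕ) :
    q ^ (n - m) ∣ (taylor θ f).coeff m := by
  have hmap : ((Ideal.span {PowerSeries.X - PowerSeries.C θ, PowerSeries.C q}) ^ n).map sh.toRingHom =
      (Ideal.span {PowerSeries.X, PowerSeries.C q}) ^ n := by
    rw [Ideal.map_pow, Ideal.map_span, Set.image_pair]
    change Ideal.span {sh (PowerSeries.X - PowerSeries.C θ), sh (PowerSeries.C q)} ^ n = _
    rw [map_sub, hX, hC, hC, add_sub_cancel_right]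
  have hmem : sh (f : PowerSeries S) ∈ (Ideal.span {PowerSeries.X, PowerSeries.C q}) ^ n := by
    rw [← hmap]; exact Ideal.mem_map_of_mem sh.toRingHom hf
  have h2 : sh (f : PowerSeries S) = ((taylor θ f : S[X]) : PowerSeries S) :=
    map_coe_eq_coe_taylor sh.toRingHom hX hC f
  rw [h2] at hmem
  rw [← Polynomial.coeff_coe]
  exact PowerSeries.dvd_coeff_of_mem_span_X_C_pow q hmem m

/-- **`f ≡ (Z − θ)^n (mod q)`**: a monic `f` of degree `n` whose Taylor coefficients at `θ` of order
`< n` are divisible by `q` reduces to `(X − θ̄)^n` modulo `q` (Mulay 3.4: "`f(Z) = c g(Z)^d` … and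
`g(Z) = Z + θ`", here over `S/(q)` rather than its fraction field). [cite: Mulay1983, 3.4 p. 411] -/
theorem map_eq_X_sub_C_pow_of_taylor {f : S[X]} (hmon : f.Monic) {θ q : S}
    (hT : ∀ m < f.natDegree, q ∣ (taylor θ f).coeff m) :
    f.map (Ideal.Quotient.mk (Ideal.span {q})) =
      (X - C (Ideal.Quotient.mk (Ideal.span {q}) θ)) ^ f.natDegree := by
  set n := f.natDegree with hndef
  set π := Ideal.Quotient.mk (Ideal.span {q}) with hπdef
  -- `taylor θ f ≡ X ^ n`
  have htay : (taylor θ f).map π = X ^ n := by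
    ext m
    rw [Polynomial.coeff_map, Polynomial.coeff_X_pow]
    rcases lt_trichotomy m n with hm | rfl | hm
    · rw [if_neg hm.ne, Ideal.Quotient.eq_zero_iff_mem, Ideal.mem_span_singleton]; exact hT m hm
    · rw [if_pos rfl, coeff_taylor_natDegree, hmon.leadingCoeff, map_one]
    · rw [if_neg hm.ne', Polynomial.coeff_eq_zero_of_natDegree_lt (by rwa [natDegree_taylor]), map_zero]
  -- `f = (taylor θ f).comp (X − θ)`
  have hcomp : f = (taylor θ f).comp (X - C θ) := by
    rw [taylor_apply, Polynomial.comp_assoc, add_comp, X_comp, C_comp, sub_add_cancel, Polynomial.comp_X]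
  conv_lhs => rw [hcomp]
  rw [Polynomial.map_comp, htay, Polynomial.map_sub, Polynomial.map_X, Polynomial.map_C, X_pow_comp]

/-- In a reduced ring, `(X − a)^n = (X − b)^n` with `n ≠ 0` forces `a = b` (Mulay 3.5: the prime
`Q` under `P` determines `P`). [cite: Mulay1983, 3.5 p. 411] -/
theorem eq_of_X_sub_C_pow_eq {D : Type u} [CommRing D] [IsReduced D] {a b : D} {n : ℕ} (hn : n ≠ 0)
    (h : (X - C a) ^ n = (X - C b) ^ n) : a = b := by
  have := congrArg (Polynomial.eval a) h
  simp only [eval_pow, eval_sub, eval_X, eval_C, sub_self, zero_pow hn] at this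
  exact (sub_eq_zero.mp (IsReduced.eq_zero _ ⟨n, this.symm⟩))

end Taylor

/-! ## 5. Weierstrass normal form of an ideal containing a `T`-regular element of order one -/

section NormalForm

variable {L : Type u} [Field L] {σ : Type v} [Finite σ]

/-- **Normal form `(w, v) = (T − θ, q)`.** Over `S = L⟦x_σ⟧`: if `w ∈ S⟦T⟧` has constant term
`[T⁰]w ∈ 𝔪_S` and `[T¹]w` a unit (i.e. `w` is `T`-regular of order one), then for every `v ∈ S⟦T⟧`
there are `θ ∈ 𝔪_S` and `q ∈ S` with `(w, v) = (T − C θ, C q)` as ideals of `S⟦T⟧`. (Weierstrass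
preparation in degree one, Mathlib `PowerSeries.weierstrassDistinguished`, gives `(w) = (T − θ)`;
then `v ≡ C q (mod T − θ)` with `q` the constant term of the shifted `v`: Mulay 2.4 + 3.1 (iii)
"`P = (Z − θ)A + QA`".) [cite: Mulay1983, 2.4 and 3.1 (iii), pp. 409–410] -/
theorem exists_span_pair_eq_span_X_sub_C (w v : PowerSeries (MvPowerSeries σ L))
    (hw0 : MvPowerSeries.constantCoeff (PowerSeries.coeff 0 w) = 0)
    (hw1 : IsUnit (PowerSeries.coeff 1 w)) :
    ∃ θ q : MvPowerSeries σ L, MvPowerSeries.constantCoeff θ = 0 ∧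
      Ideal.span {w, v} = Ideal.span {PowerSeries.X - PowerSeries.C θ, PowerSeries.C q} := by
  classical
  haveI : IsAdicComplete (maximalIdeal (MvPowerSeries σ L)) (MvPowerSeries σ L) := by
    rw [maximalIdeal_mvPowerSeries_eq_span L σ]; infer_instance
  let S := MvPowerSeries σ L
  -- the reduction of `w` has order one
  have hres1 : PowerSeries.coeff 1 (w.map (residue S)) ≠ 0 := by
    rw [PowerSeries.coeff_map]; exact (residue_ne_zero_iff_isUnit _).mpr hw1
  have hres0 : PowerSeries.coeff 0 (w.map (residue S)) = 0 := by
    rw [PowerSeries.coeff_map]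
    exact (residue_eq_zero_iff _).mpr (Jets.mem_maximalIdeal_iff_constantCoeff_eq_zero.mpr hw0)
  have hg : w.map (residue S) ≠ 0 := fun h => hres1 (by rw [h, map_zero])
  have horder : (w.map (residue S)).order = 1 := by
    rw [show (1 : ℕ∞) = ((1 : ℕ) : ℕ∞) from rfl, PowerSeries.order_eq_nat]
    refine ⟨hres1, fun j hj => ?_⟩
    interval_cases j
    exact hres0
  -- Weierstrass preparation: `w = f · u`, `f = X + C b` distinguished
  set f : S[X] := w.weierstrassDistinguished hg with hfdef
  have H := w.isWeierstrassFactorization_weierstrassDistinguished_weierstrassUnit hg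
  have hdeg : f.natDegree = 1 := by
    have h := H.natDegree_eq_toNat_order_map_of_ne_top (maximalIdeal.isMaximal S).ne_top
    rw [← hfdef] at h
    rw [h]
    change (w.map (residue S)).order.toNat = 1
    rw [horder]; rfl
  have hmonic : f.Monic := H.isDistinguishedAt.monic
  set b : S := f.coeff 0 with hbdef
  have hb : b ∈ maximalIdeal S := H.isDistinguishedAt.mem (by rw [hdeg]; exact Nat.zero_lt_one)
  have hfX : f = Polynomial.X + Polynomial.C b := hmonic.eq_X_add_C hdeg
  set θ : S := -b with hθdef
  have hθ : MvPowerSeries.constantCoeff θ = 0 := by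
    rw [hθdef, map_neg, neg_eq_zero]
    exact Jets.mem_maximalIdeal_iff_constantCoeff_eq_zero.mp hb
  have hspanw : Ideal.span {w} = Ideal.span {PowerSeries.X - PowerSeries.C θ} := by
    rw [H.eq_mul, Ideal.span_singleton_mul_right_unit H.isUnit, ← hfdef, hfX, Polynomial.coe_add,
      Polynomial.coe_X, Polynomial.coe_C, hθdef, map_neg, sub_neg_eq_add]
  -- shift and read off `q`
  obtain ⟨sh, hX, hC⟩ := exists_shift θ hθ
  set v' := sh v with hv'def
  set q : S := PowerSeries.constantCoeff v' with hqdef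
  have hv' : v' = PowerSeries.X * (PowerSeries.mk fun p => PowerSeries.coeff (p + 1) v') + PowerSeries.C q :=
    PowerSeries.eq_X_mul_shift_add_const v'
  have hshX : sh.symm PowerSeries.X = PowerSeries.X - PowerSeries.C θ := by
    apply sh.injective
    rw [RingEquiv.apply_symm_apply, map_sub, hX, hC, add_sub_cancel_right]
  have hv : v = PowerSeries.C q + sh.symm (PowerSeries.mk fun p => PowerSeries.coeff (p + 1) v') *
      (PowerSeries.X - PowerSeries.C θ) := by
    have := congrArg sh.symm hv'
    rw [hv'def, RingEquiv.symm_apply_apply] at this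
    rw [this, map_add, map_mul, hshX, ← hv'def]
    have hCq : sh.symm (PowerSeries.C q) = PowerSeries.C q := by
      apply sh.injective; rw [RingEquiv.apply_symm_apply, hC]
    rw [hCq]; ring
  refine ⟨θ, q, hθ, ?_⟩
  calc Ideal.span {w, v} = Ideal.span {w} ⊔ Ideal.span {v} := Ideal.span_insert _ _
    _ = Ideal.span {PowerSeries.X - PowerSeries.C θ} ⊔ Ideal.span {v} := by rw [hspanw]
    _ = Ideal.span {PowerSeries.X - PowerSeries.C θ, v} := (Ideal.span_insert _ _).symm
    _ = Ideal.span {PowerSeries.X - PowerSeries.C θ, PowerSeries.C q} := by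
        conv_lhs => rw [hv]
        exact Ideal.span_pair_add_mul_left _ _ _

end NormalForm

end Mulay1983

end Literature.AlgebraicGeometry.Resolution
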